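import Summits.QuantumFields.YangMills.Theorems.ForcedResponseSkewnessFemtoEngineCoarsePin
import Literature.MathematicalPhysics.QuantumFieldTheory.AsymptoticFreedomScale
import HarnessLib

/-!
# The femto engine laws move from the engine's unit to every floor-pinned unit that is not finer — pointwise form,
# and the instance in the named two-loop asymptotic-freedom unit `LatticeRep.afUnit`

Route `ForcedResponseSkewness` (cruxes stmt-QuantumFields-26871 `ResponseLocalisation`, -24275 `RunningCouplingCeiling`), LEAD seat
`ym-line-frs-p1` g11.  The OWNER's option (ii) (ruling g11, R3) restates the cruxes' unit pinning to «clause-(i) floor at `a` ∧ the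
named unit of record is eventually not finer than `a`: `afUnit r ≤ M·a`», so that the crux-side debt becomes PURE ENGINE OUTPUT IN THE
NAMED UNIT, `FemtoEngineAt G r (afUnit r)`.  This file is the composition the restated skeletons will use, proved NOW on the landed
g7 bookkeeping (`floorPins_coarse_of_femtoEngineAt`, `femtoEngineAt_of_unit`):

* `femtoEngineAt_of_fine_pinned` — unit-generic: `FemtoEngineAt G r u` (positive `u`), a unit `a → 0⁺` carrying a compact-witness
  clause-(i) floor, and `u ≤ M·a` eventually ⇒ `FemtoEngineAt G r a`.  (The coarse side `a ≤ M′·u` is DERIVED from the engine's log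
  ceiling; `u → 0` follows from `u ≤ M·a`, `a → 0` — no Lie theory about `afUnit` is needed.)
* `femtoEngineAt_of_afUnit_pinned` — the instance `u := afUnit r` (Literature `AsymptoticFreedomScale.lean`, p640875).

Honest label: bookkeeping; `FemtoEngineAt G r (afUnit r)` (E0′ ∧ E-sym ∧ E-log in the two-loop unit) is the Bałaban-class engine output and
is NOT proved; nothing of the residual 24873, NT (R2a leaf) or the Yang–Mills mass gap is proved here.
-/

noncomputable section

namespace Summit.QuantumFields.YangMills.Cruxes.ResponseLocalisation.FemtoEngine

open scoped SchwartzMap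
open MeasureTheory Filter Topology Set Metric
open Literature.MathematicalPhysics.QuantumFieldTheory Literature.MathematicalPhysics.QuantumLattice
open Literature.Probability.LatticeModels
open Summit.QuantumFields.YangMills.Cruxes.OSLegsFromFemtoAndGap.DlrCollarTransfer
open Summit.QuantumFields.YangMills.Cruxes.ResponseLocalisation.Birth

variable {G : Type} [Group G] [TopologicalSpace G] [IsTopologicalGroup G] [CompactSpace G]
  [MeasurableSpace G] [BorelSpace G] (r : LatticeRep G)

/-- A positive unit dominated by a multiple of a unit tending to `0` tends to `0`. -/
theorem tendsto_zero_of_le_mul {a u : ℝ → ℝ} (hu : ∀ β, 0 < u β) (ha0 : Tendsto a atTop (𝓝 0)) {M : ℝ}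
    (hle : ∀ᶠ β in atTop, u β ≤ M * a β) : Tendsto u atTop (𝓝 0) := by
  have hM : Tendsto (fun β => M * a β) atTop (𝓝 0) := by simpa using ha0.const_mul M
  exact tendsto_of_tendsto_of_tendsto_of_le_of_le' tendsto_const_nhds hM
    (Eventually.of_forall fun β => (hu β).le) hle

/-- **The engine laws move to every floor-pinned unit that is not finer (pointwise).**  `FemtoEngineAt G r u` for a positive unit
`u`, a unit `a → 0⁺` carrying a compact-witness clause-(i) floor, and `u ≤ M·a` eventually give `FemtoEngineAt G r a`: the coarse
comparison `a ≤ M′·u` is the engine's log ceiling against the floor (`floorPins_coarse_of_femtoEngineAt`), and the three laws move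
between two-sidedly comparable units (`femtoEngineAt_of_unit`). -/
theorem femtoEngineAt_of_fine_pinned {u a : ℝ → ℝ} (hu : ∀ β, 0 < u β) (hE : FemtoEngineAt G r u)
    (ha : ∀ β, 0 < a β) (ha0 : Tendsto a atTop (𝓝 0))
    (hfloor : ∃ (v₀ : 𝓢(EuclideanSpace ℝ (Fin 4), ℝ)) (ε β₅ Λ₅ : ℝ),
      HasCompactSupport (v₀ : EuclideanSpace ℝ (Fin 4) → ℝ) ∧
      tsupport (v₀ : EuclideanSpace ℝ (Fin 4) → ℝ) ⊆ {y : EuclideanSpace ℝ (Fin 4) | 0 < y 0} ∧ 0 < ε ∧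
      ∀ β : ℝ, β₅ ≤ β → ∀ L : ℕ, Λ₅ ≤ a β * L → ε ≤ Q2 G r β L (a β) (thetaTest 4 v₀) v₀)
    (hfine : ∃ M : ℝ, ∀ᶠ β in atTop, u β ≤ M * a β) : FemtoEngineAt G r a := by
  obtain ⟨M, hM⟩ := hfine
  have hu0 : Tendsto u atTop (𝓝 0) := tendsto_zero_of_le_mul hu ha0 hM
  obtain ⟨M', hM'0, hcoarse⟩ := floorPins_coarse_of_femtoEngineAt r hu hu0 hE ha ha0 hfloor
  -- two-sided comparison `(1/M')·a ≤ u ≤ M·a` eventually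
  have hle : ∀ᶠ β in atTop, (1 / M') * a β ≤ u β ∧ u β ≤ M * a β := by
    filter_upwards [hcoarse, hM] with β h1 h2
    refine ⟨?_, h2⟩
    rw [one_div, inv_mul_le_iff₀ hM'0]
    exact h1
  exact femtoEngineAt_of_unit r (by positivity) ha hu hle hE

/-- **The instance in the named unit of record**: engine output `FemtoEngineAt G r (afUnit r)` in the two-loop asymptotic-freedom unit
of `(G, r)` (Literature `LatticeRep.afUnit`), a floor-pinned unit `a → 0⁺`, and the option-(ii) pinning hypothesis
`afUnit r ≤ M·a` eventually give the three laws along `a`. -/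
theorem femtoEngineAt_of_afUnit_pinned {a : ℝ → ℝ} (hE : FemtoEngineAt G r r.afUnit)
    (ha : ∀ β, 0 < a β) (ha0 : Tendsto a atTop (𝓝 0))
    (hfloor : ∃ (v₀ : 𝓢(EuclideanSpace ℝ (Fin 4), ℝ)) (ε β₅ Λ₅ : ℝ),
      HasCompactSupport (v₀ : EuclideanSpace ℝ (Fin 4) → ℝ) ∧
      tsupport (v₀ : EuclideanSpace ℝ (Fin 4) → ℝ) ⊆ {y : EuclideanSpace ℝ (Fin 4) | 0 < y 0} ∧ 0 < ε ∧
      ∀ β : ℝ, β₅ ≤ β → ∀ L : ℕ, Λ₅ ≤ a β * L → ε ≤ Q2 G r β L (a β) (thetaTest 4 v₀) v₀)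
    (hfine : ∃ M β₇ : ℝ, ∀ β : ℝ, β₇ ≤ β → r.afUnit β ≤ M * a β) : FemtoEngineAt G r a := by
  obtain ⟨M, β₇, hM⟩ := hfine
  exact femtoEngineAt_of_fine_pinned r (r.afUnit_pos) hE ha ha0 hfloor
    ⟨M, Filter.eventually_atTop.2 ⟨β₇, hM⟩⟩

end Summit.QuantumFields.YangMills.Cruxes.ResponseLocalisation.FemtoEngine

end
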